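import Literature.NumberTheory.LFunctions.WeilExplicitContinuous
import HarnessLib

/-!
# PF persistence — GAL-0 piece (ii), STEP 3c: the Weil functional along SQUARED mollifiers
# (pub-rhpf barrier-prover g2)

HONEST FRAMING: long-odds mechanism search; no RH claims.  Generic complement to the tree's
`Literature/NumberTheory/LFunctions/WeilExplicitContinuous.lean` (the mollification engine
`W(g ⋆ φ_k) → W(g)` for `g` continuous with compact support and integrable archimedean integrand).

Why squared mollifiers: the test functions approximating a cut-off Galerkin profile `F` in the
FORM sense are `g_k = F ⋆ φ_k`, and their autocorrelations are
`g_k ⋆ g̃_k = (F ⋆ F̃) ⋆ (φ_k ⋆ φ_k)` (`φ_k` is real and even), i.e. the autocorrelation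
`A = F ⋆ F̃` mollified by the SQUARED mollifier `ν_k = φ_k ⋆ φ_k`, not by `φ_k`.  This file runs
the engine along `ν_k`:

* `mollSq k = φ_k ⋆ φ_k`: a Weil test function, real and non-negative, `∫ ν_k = 1`,
  `ν_k(x) = 0` for `|x| ≥ 2 r_k`, `ν̂_k = φ̂_k²`, `|ν̂_k(½+it)| ≤ 1`, `ν̂_k(s) → 1`;
* `tendsto_weilConv_mollSq` — `(g ⋆ ν_k)(x) → g(x)` for continuous `g`;
* `tendsto_weilPrimeTerm_mollSq`, `tendsto_weilPolarTerm_mollSq`, `tendsto_weilArchIntegral_mollSq`,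
  **`tendsto_weilFunctional_mollSq`** — `W(g ⋆ ν_k) → W(g)` under the engine's hypotheses
  (`g` continuous, compact support, `t ↦ ĝ(½+it) Re ψ(¼+it/2)` integrable).

All proofs follow the tree's engine line by line (RH-free, no data, no named facts).
-/

set_option linter.dupNamespace false

noncomputable section

open Complex Filter Set MeasureTheory Topology
open scoped Real Convolution ComplexConjugate ContDiff

namespace Summit.RiemannHypothesis.RiemannHypothesis.Theorems.PfPersistence

open Literature.NumberTheory.LFunctions Literature.NumberTheory.LFunctions.WeilContinuous

/-! ## §1 The squared mollifier `ν_k = φ_k ⋆ φ_k` -/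

/-- The squared mollifier `ν_k = φ_k ⋆ φ_k`. [folklore] -/
def mollSq (k : ℕ) : ℝ → ℂ := weilConv (moll k) (moll k)

/-- `ν_k` is a Weil test function. [folklore] -/
theorem isWeilTest_mollSq (k : ℕ) : IsWeilTest (mollSq k) :=
  isWeilTest_weilConv_moll (continuous_moll k) (hasCompactSupport_moll k) k

/-- `ν_k` is continuous. [folklore] -/
theorem continuous_mollSq (k : ℕ) : Continuous (mollSq k) := (isWeilTest_mollSq k).1.continuous

/-- `ν_k` has compact support. [folklore] -/
theorem hasCompactSupport_mollSq (k : ℕ) : HasCompactSupport (mollSq k) := (isWeilTest_mollSq k).2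

/-- `ν_k(x) = ∫ φ_k(u) φ_k(x-u) du`. [folklore] -/
theorem mollSq_apply (k : ℕ) (x : ℝ) : mollSq k x = ∫ u : ℝ, moll k u * moll k (x - u) :=
  weilConv_apply _ _ x

/-- `ν_k(x) = 0` for `|x| ≥ 2 r_k`. [folklore] -/
theorem mollSq_eq_zero {k : ℕ} {x : ℝ} (hx : 2 * (bump k).rOut ≤ |x|) : mollSq k x = 0 := by
  rw [mollSq_apply]
  refine integral_eq_zero_of_ae (Eventually.of_forall fun u ↦ ?_)
  simp only [Pi.zero_apply]
  rcases le_or_gt (bump k).rOut |u| with hu | hu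
  · rw [moll_eq_zero hu, zero_mul]
  · have h : (bump k).rOut ≤ |x - u| := by
      have := abs_sub_abs_le_abs_sub x u
      linarith
    rw [moll_eq_zero h, mul_zero]

/-- `ν_k` is real and non-negative. [folklore] -/
theorem mollSq_eq_ofReal_nonneg (k : ℕ) (x : ℝ) : ∃ r : ℝ, 0 ≤ r ∧ mollSq k x = r := by
  refine ⟨∫ u : ℝ, (bump k).normed volume u * (bump k).normed volume (x - u),
    integral_nonneg fun u ↦ mul_nonneg ((bump k).nonneg_normed _) ((bump k).nonneg_normed _), ?_⟩
  rw [mollSq_apply, ← integral_complex_ofReal]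
  refine integral_congr_ae (Eventually.of_forall fun u ↦ ?_)
  simp only [moll]
  push_cast
  ring

/-- `‖ν_k(x)‖ = ν_k(x)` (as a real number cast back). [folklore] -/
theorem ofReal_norm_mollSq (k : ℕ) (x : ℝ) : ((‖mollSq k x‖ : ℝ) : ℂ) = mollSq k x := by
  obtain ⟨r, hr, h⟩ := mollSq_eq_ofReal_nonneg k x
  rw [h, Complex.norm_real, Real.norm_of_nonneg hr]

/-- `ν_k` is integrable. [folklore] -/
theorem integrable_mollSq (k : ℕ) : Integrable (mollSq k) :=
  (continuous_mollSq k).integrable_of_hasCompactSupport (hasCompactSupport_mollSq k)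

/-- `‖ν_k‖` is integrable. [folklore] -/
theorem integrable_norm_mollSq (k : ℕ) : Integrable fun x ↦ ‖mollSq k x‖ := (integrable_mollSq k).norm

/-- `∫ ν_k = 1`. [folklore] -/
theorem integral_mollSq (k : ℕ) : ∫ x, mollSq k x = 1 := by
  have hint : Integrable (moll k) :=
    (continuous_moll k).integrable_of_hasCompactSupport (hasCompactSupport_moll k)
  unfold mollSq weilConv
  rw [integral_convolution (ContinuousLinearMap.mul ℂ ℂ) hint hint, integral_moll]
  simp

/-- `∫ ‖ν_k‖ = 1`. [folklore] -/
theorem integral_norm_mollSq (k : ℕ) : ∫ x, ‖mollSq k x‖ = 1 := by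
  have h : ((∫ x, ‖mollSq k x‖ : ℝ) : ℂ) = 1 := by
    rw [← integral_complex_ofReal]
    simp_rw [ofReal_norm_mollSq]
    exact integral_mollSq k
  exact_mod_cast h

/-- `ν̂_k = φ̂_k²`. [folklore] -/
theorem weilMellin_mollSq (k : ℕ) (s : ℂ) : weilMellin (mollSq k) s = weilMellin (moll k) s ^ 2 := by
  rw [mollSq, weilMellin_weilConv_moll (continuous_moll k) (hasCompactSupport_moll k), sq]

/-- On the critical line `|ν̂_k(½+it)| ≤ 1`. [folklore] -/
theorem norm_weilMellin_mollSq_half_le (k : ℕ) (t : ℝ) :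
    ‖weilMellin (mollSq k) (1 / 2 + t * I)‖ ≤ 1 := by
  rw [weilMellin_mollSq, norm_pow]
  exact pow_le_one₀ (norm_nonneg _) (norm_weilMellin_moll_half_le k t)

/-- `ν̂_k(s) → 1`. [folklore] -/
theorem tendsto_weilMellin_mollSq (s : ℂ) :
    Tendsto (fun k ↦ weilMellin (mollSq k) s) atTop (𝓝 1) := by
  have h := (tendsto_weilMellin_moll s).pow 2
  simp only [one_pow] at h
  refine h.congr fun k ↦ ?_
  rw [weilMellin_mollSq]

/-! ## §2 Mollification by `ν_k` of a continuous compactly supported function -/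

variable {g : ℝ → ℂ}

/-- `g ⋆ ν_k` is a test function when `g` is continuous with compact support. [folklore] -/
theorem isWeilTest_weilConv_mollSq (hgc : Continuous g) (hgs : HasCompactSupport g) (k : ℕ) :
    IsWeilTest (weilConv g (mollSq k)) := by
  rw [weilConv_eq_convolution_real]
  exact ⟨(hasCompactSupport_mollSq k).contDiff_convolution_right (ContinuousLinearMap.mul ℝ ℂ)
      hgc.locallyIntegrable (isWeilTest_mollSq k).1,
    HasCompactSupport.convolution (L := ContinuousLinearMap.mul ℝ ℂ) hgs (hasCompactSupport_mollSq k)⟩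

/-- `(g ⋆ ν_k)^ = ĝ · ν̂_k`. [folklore] -/
theorem weilMellin_weilConv_mollSq (hgc : Continuous g) (hgs : HasCompactSupport g) (k : ℕ) (s : ℂ) :
    weilMellin (weilConv g (mollSq k)) s = weilMellin g s * weilMellin (mollSq k) s :=
  weilMellin_weilConv_holds hgc hgs (continuous_mollSq k) (hasCompactSupport_mollSq k) s

/-- **Approximate identity**: `(g ⋆ ν_k)(x) → g(x)` for continuous `g`. [folklore] -/
theorem tendsto_weilConv_mollSq (hgc : Continuous g) (x : ℝ) :
    Tendsto (fun k ↦ weilConv g (mollSq k) x) atTop (𝓝 (g x)) := by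
  rw [Metric.tendsto_nhds]
  intro ε hε
  obtain ⟨δ, hδ, hδg⟩ := Metric.continuous_iff.1 hgc x (ε / 2) (by positivity)
  have hk : ∀ᶠ k : ℕ in atTop, 2 * (bump k).rOut < δ := by
    have h2 : Tendsto (fun k ↦ 2 * (bump k).rOut) atTop (𝓝 (2 * 0)) := tendsto_bump_rOut.const_mul 2
    rw [mul_zero] at h2
    exact (tendsto_order.1 h2).2 δ hδ
  filter_upwards [hk] with k hk
  have hconv : weilConv g (mollSq k) x = ∫ u : ℝ, g u * mollSq k (x - u) := weilConv_apply g (mollSq k) x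
  have hone : ∫ u : ℝ, mollSq k (x - u) = 1 := by
    rw [integral_sub_left_eq_self (fun u ↦ mollSq k u) volume x, integral_mollSq]
  have hgx : g x = ∫ u : ℝ, g x * mollSq k (x - u) := by
    rw [MeasureTheory.integral_const_mul, hone, mul_one]
  have hint1 : Integrable fun u : ℝ ↦ g u * mollSq k (x - u) := by
    have hc : Continuous fun u : ℝ ↦ g u * mollSq k (x - u) :=
      hgc.mul ((continuous_mollSq k).comp (by fun_prop))
    refine hc.integrable_of_hasCompactSupport ?_
    exact ((hasCompactSupport_mollSq k).comp_homeomorph (Homeomorph.subLeft x)).mul_left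
  have hint2 : Integrable fun u : ℝ ↦ g x * mollSq k (x - u) := by
    have hc : Continuous fun u : ℝ ↦ mollSq k (x - u) := (continuous_mollSq k).comp (by fun_prop)
    exact (hc.integrable_of_hasCompactSupport
      ((hasCompactSupport_mollSq k).comp_homeomorph (Homeomorph.subLeft x))).const_mul _
  rw [dist_eq_norm, hconv, hgx, ← integral_sub hint1 hint2]
  have hb : ∀ u : ℝ, ‖g u * mollSq k (x - u) - g x * mollSq k (x - u)‖ ≤ ε / 2 * ‖mollSq k (x - u)‖ := by
    intro u
    rw [← sub_mul, norm_mul]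
    rcases le_or_gt (2 * (bump k).rOut) |x - u| with hu | hu
    · rw [mollSq_eq_zero hu]; simp
    · refine mul_le_mul_of_nonneg_right ?_ (norm_nonneg _)
      have hdist : dist u x < δ := by
        rw [dist_comm, Real.dist_eq]; exact hu.trans hk
      exact (le_of_lt (by simpa [dist_eq_norm] using hδg u hdist))
  calc ‖∫ u : ℝ, (g u * mollSq k (x - u) - g x * mollSq k (x - u))‖
      ≤ ∫ u : ℝ, ‖g u * mollSq k (x - u) - g x * mollSq k (x - u)‖ := norm_integral_le_integral_norm _
    _ ≤ ∫ u : ℝ, ε / 2 * ‖mollSq k (x - u)‖ :=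
        integral_mono_of_nonneg (Eventually.of_forall fun _ ↦ norm_nonneg _)
          (((integrable_norm_mollSq k).comp_sub_left x).const_mul _) (Eventually.of_forall hb)
    _ = ε / 2 := by
        rw [MeasureTheory.integral_const_mul, integral_sub_left_eq_self (fun u ↦ ‖mollSq k u‖) volume x,
          integral_norm_mollSq, mul_one]
    _ < ε := by linarith

/-- `g ⋆ ν_k` vanishes two units beyond the support radius of `g`. [folklore] -/
theorem weilConv_mollSq_eq_zero {R : ℝ} (hgs : ∀ u : ℝ, R < |u| → g u = 0) {x : ℝ}
    (hx : R + 2 < |x|) (k : ℕ) : weilConv g (mollSq k) x = 0 := by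
  rw [weilConv_apply]
  refine integral_eq_zero_of_ae (Eventually.of_forall fun u ↦ ?_)
  simp only [Pi.zero_apply]
  rcases le_or_gt (2 * (bump k).rOut) |x - u| with hu | hu
  · rw [mollSq_eq_zero hu, mul_zero]
  · have h1 : |x - u| < 2 := hu.trans_le (by linarith [bump_rOut_le_one k])
    have h2 : R < |u| := by
      have := abs_sub_abs_le_abs_sub x u
      linarith
    rw [hgs u h2, zero_mul]

/-! ## §3 The three sides along `ν_k` -/

/-- Convergence of the prime term along `ν_k`. [folklore] -/
theorem tendsto_weilPrimeTerm_mollSq (hgc : Continuous g) (hgs : HasCompactSupport g) :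
    Tendsto (fun k ↦ weilPrimeTerm (weilConv g (mollSq k))) atTop (𝓝 (weilPrimeTerm g)) := by
  obtain ⟨R, hR0, hR⟩ := exists_support_radius hgs
  have hRk : ∀ k, ∀ u : ℝ, (R + 1) + 1 < |u| → weilConv g (mollSq k) u = 0 := fun k u hu ↦
    weilConv_mollSq_eq_zero hR (by linarith) k
  have hR' : ∀ u : ℝ, (R + 1) + 1 < |u| → g u = 0 := fun u hu ↦ hR u (by linarith)
  rw [weilPrimeTerm_eq_sum_of_support hR']
  simp_rw [weilPrimeTerm_eq_sum_of_support (hRk _)]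
  refine tendsto_finsetSum _ fun n _ ↦ ?_
  exact tendsto_const_nhds.mul ((tendsto_weilConv_mollSq hgc _).add (tendsto_weilConv_mollSq hgc _))

/-- Convergence of the polar term along `ν_k`. [folklore] -/
theorem tendsto_weilPolarTerm_mollSq (hgc : Continuous g) (hgs : HasCompactSupport g) :
    Tendsto (fun k ↦ weilPolarTerm (weilConv g (mollSq k))) atTop (𝓝 (weilPolarTerm g)) := by
  unfold weilPolarTerm
  simp_rw [weilMellin_weilConv_mollSq hgc hgs]
  have h0 := (tendsto_weilMellin_mollSq 0).const_mul (weilMellin g 0)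
  have h1 := (tendsto_weilMellin_mollSq 1).const_mul (weilMellin g 1)
  simpa using h0.add h1

/-- Convergence of the archimedean integral along `ν_k` (dominated convergence). [folklore] -/
theorem tendsto_weilArchIntegral_mollSq (hgc : Continuous g) (hgs : HasCompactSupport g)
    (hA : Integrable fun t : ℝ ↦ weilMellin g (1 / 2 + t * I) *
      ((Complex.digamma (1 / 4 + t / 2 * I)).re : ℂ)) :
    Tendsto (fun k ↦ weilArchIntegral (weilConv g (mollSq k))) atTop (𝓝 (weilArchIntegral g)) := by
  unfold weilArchIntegral
  simp_rw [weilMellin_weilConv_mollSq hgc hgs]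
  refine tendsto_integral_of_dominated_convergence
    (fun t ↦ ‖weilMellin g (1 / 2 + t * I) * ((Complex.digamma (1 / 4 + t / 2 * I)).re : ℂ)‖)
    ?_ hA.norm ?_ ?_
  · intro k
    have hc : Continuous fun t : ℝ ↦ weilMellin (mollSq k) (1 / 2 + t * I) :=
      (continuous_weilMellin (continuous_mollSq k) (hasCompactSupport_mollSq k)).comp (by fun_prop)
    have heq : (fun t : ℝ ↦ weilMellin g (1 / 2 + t * I) * weilMellin (mollSq k) (1 / 2 + t * I) *
        ((Complex.digamma (1 / 4 + t / 2 * I)).re : ℂ)) = fun t : ℝ ↦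
        (weilMellin g (1 / 2 + t * I) * ((Complex.digamma (1 / 4 + t / 2 * I)).re : ℂ)) *
          weilMellin (mollSq k) (1 / 2 + t * I) := by
      funext t; ring
    rw [heq]
    exact hA.aestronglyMeasurable.mul hc.aestronglyMeasurable
  · intro k
    refine Eventually.of_forall fun t ↦ ?_
    have h1 := norm_weilMellin_mollSq_half_le k t
    calc ‖weilMellin g (1 / 2 + t * I) * weilMellin (mollSq k) (1 / 2 + t * I) *
          ((Complex.digamma (1 / 4 + t / 2 * I)).re : ℂ)‖
        = ‖weilMellin g (1 / 2 + t * I) * ((Complex.digamma (1 / 4 + t / 2 * I)).re : ℂ)‖ *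
            ‖weilMellin (mollSq k) (1 / 2 + t * I)‖ := by
          rw [norm_mul, norm_mul, norm_mul]; ring
      _ ≤ ‖weilMellin g (1 / 2 + t * I) * ((Complex.digamma (1 / 4 + t / 2 * I)).re : ℂ)‖ * 1 := by
          gcongr
      _ = _ := mul_one _
  · refine Eventually.of_forall fun t ↦ ?_
    have h := ((tendsto_weilMellin_mollSq (1 / 2 + t * I)).const_mul
      (weilMellin g (1 / 2 + t * I))).mul_const ((Complex.digamma (1 / 4 + t / 2 * I)).re : ℂ)
    simpa using h

/-- **Convergence of the Weil functional along the squared mollifiers**: `W(g ⋆ ν_k) → W(g)`.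
[folklore] -/
theorem tendsto_weilFunctional_mollSq (hgc : Continuous g) (hgs : HasCompactSupport g)
    (hA : Integrable fun t : ℝ ↦ weilMellin g (1 / 2 + t * I) *
      ((Complex.digamma (1 / 4 + t / 2 * I)).re : ℂ)) :
    Tendsto (fun k ↦ weilFunctional (weilConv g (mollSq k))) atTop (𝓝 (weilFunctional g)) := by
  unfold weilFunctional weilArchTerm
  refine ((tendsto_weilPolarTerm_mollSq hgc hgs).sub (tendsto_weilPrimeTerm_mollSq hgc hgs)).add ?_
  refine ((tendsto_weilArchIntegral_mollSq hgc hgs hA).const_mul _).sub ?_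
  exact (tendsto_weilConv_mollSq hgc 0).mul_const _

/-- Pointwise convergence at `0` (the `L²`-mass of the approximating tests). [folklore] -/
theorem tendsto_weilConv_mollSq_zero (hgc : Continuous g) :
    Tendsto (fun k ↦ weilConv g (mollSq k) 0) atTop (𝓝 (g 0)) :=
  tendsto_weilConv_mollSq hgc 0

end Summit.RiemannHypothesis.RiemannHypothesis.Theorems.PfPersistence
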